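import Summits.QuantumFields.BalabanUV.Beta.SymmetrisedDressingDress
import Summits.QuantumFields.BalabanUV.Beta.AxialDressingRootedLegs
import Summits.QuantumFields.BalabanUV.Beta.BorderedHessianSymmetry

/-!
# Road «BF-x» — (J1) RESIDUE, PART A: ROW-PARITY-ODDNESS, THE VANISHING mm BLOCK AND BLOCK COVARIANCE SURVIVE THE ROOTED STENCIL DRESSINGS
# (unit `b2b-balaban-beta-d1-formalise-leaf-01`, gen 27 — head lineage of the (L1)(L2) packaging; OWNER d1-p2 g21's `J1-RESIDUE-SPEC.md` v0 §2 rows S2–S5, generic half)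

HONEST DEPENDENCY (page 1, mandatory): continuum YM on T⁴ ⇐ BetaPertH ∧ nine spine estimates (0/9 proved); BetaPertH ⇐ (D1) ∧ (D4) ∧ CAP+tail;
G-an2-4 gates asym, D1 and NE2/3/4.  HONEST FRAMING (cell contract, verbatim): «discharging `BetaPertH` makes Bałaban's UV stability UNCONDITIONAL — a real
constructive-QFT result; it is NOT the continuum limit and NOT the Clay problem.»  THIS FILE: [folklore] finite-sum bookkeeping over OUR typed objects (an2's rooted
comb dressing `dressAt` = `dressKAt ∘ coProjAtK` on the `.S` slot, `AxialDressingRootedLegs` §4–§8, and its block-mean twin `dressSymAt` = `dressKSymAt ∘ coProjSymAtK`,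
`SymmetrisedDressingDress` §4–§6); no estimate of Bałaban's; discharges NO row of the wall; 0 root-level binders of row D1 discharged (hW ∕ hR-sockets ∕ hSX-socket ∕
D1Tel ∕ D1Rep); NOT D1, NOT BetaPertH, NOT continuum, NOT Clay.

WHAT IT SAYS (generic `d`, generic root `ρ`, window `N`).
* §1 TRANSPORT: the slot windows `coProjAtK ρ N` ∕ `coProjSymAtK ρ N` and the two-leg dressings `dressKAt ρ N` ∕ `dressKSymAt ρ N` (window form `legCo₂ ∘ legCo₁`,
  an2's `dressKAt_eq` ∕ `dressKSymAt_eq_legs`) PRESERVE row-parity-oddness `trK A = -sgnK A` (leaf-05's parity letter shape, `SpineRecursiveParity`) and the vanishing of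
  the multiplier–multiplier block; at `JetData` level `(dressAt hr J).S` ∕ `(dressSymAt hr J).S` inherit both, and (an2's `dressAtS_translate` ∕ `dressSymAtS_translate`,
  restated on the datum) the `(St)` block covariance.  Letters on the way: `trK (legCo₁ K) = legCo₂ (trK K)`, `sgnK ∘ legCoᵢ = legCoᵢ ∘ sgnK`, `legCoᵢ (−K) = −legCoᵢ K`,
  and THE TWO FINITE LEG WINDOWS COMMUTE (`window_comm`: `Finset.sum_comm` four times — the one non-definitional step).
* §2 THE ROAD's TWO SHAPES FROM PARITY: `trK A = -sgnK A` gives `A x y (inl c) (inr b) = A y x (inr b) (inl c)` (the END's `hSfm`) and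
  `A x y (inl c) (inl b) = -A y x (inl b) (inl c)` (the END's `hSff`).
PART B (`D1BFx/LiteralStencilSockets`) instantiates these at the (III′) literal `JsB12CombSh0` ∕ `JsB12CombShSym` and at an2's `JcOf`.
ABSOLUTE RULE (cell charter, verbatim): «No internally-minted statement may enter as a cited fact. Every hypothesis is either kernel-proved in this package or a
verbatim quotation of a PUBLISHED theorem with page reference. The manuscript(s) under audit are NOT citable for their own disputed steps — they are the thing
under adjudication; programme-internal (2001/route/tribunal) claims are never citable.»  No `def`, no `def … : Prop`, nothing cited as mathematics; 0 sorry.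
-/

noncomputable section

open Finset
open scoped BigOperators
open Literature.MathematicalPhysics.QuantumFieldTheory
open Literature.MathematicalPhysics.QuantumFieldTheory.Balaban1983to89
open Literature.MathematicalPhysics.QuantumFieldTheory.Balaban1983to89.Beta
open ExpKernelCalculus (MKer shiftK)
open OneStepResolventKernel (Fib JetData)
open AffineAveraging (box toSite)
open Summit.QuantumFields.BalabanUV.Beta.TameKernelCalculus (trK trK_apply)
open Summit.QuantumFields.BalabanUV.Beta.BorderedHessian (sgnK sgnK_apply sgnF sgnF_inl sgnF_inr)
open Summit.QuantumFields.BalabanUV.Beta.AxialDressingRooted (cube coProjAt coProjAt_apply coProjAtK coProjAtK_eval legCo₁At legCo₂At legCo₁At_inl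
  legCo₁At_inr legCo₂At_inl legCo₂At_inr dressKAt dressKAt_eq dressAt dressAt_S dressAtS_translate one_le_of_neZero)
open Summit.QuantumFields.BalabanUV.Beta.SymmetrisedDressingLegs (coProjSymAt coProjSymAt_apply legCo₁SymAt legCo₂SymAt legCo₁SymAt_inl legCo₁SymAt_inr
  legCo₂SymAt_inl legCo₂SymAt_inr dressKSymAt_eq_legs)
open Summit.QuantumFields.BalabanUV.Beta.SymmetrisedDressingKernel (dressKSymAt)
open Summit.QuantumFields.BalabanUV.Beta.SymmetrisedDressingDress (coProjSymAtK coProjSymAtK_eval dressSymAt dressSymAt_S dressSymAtS_translate)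

namespace Summit.QuantumFields.BalabanUV.Beta.D1BFx.DressingParityTransport

variable {d : ℕ}

/-! ## §1 Transport of row-parity-oddness, the vanishing mm block and block covariance through the rooted dressings (generic `d`) -/

section Transport

/-- [folklore] **THE TWO FINITE LEG WINDOWS COMMUTE** (`Finset.sum_comm`, four times): the only non-definitional step of the transport. -/
theorem window_comm {ι κ : Type*} (C : Finset ι) [Fintype κ] (p q : ι → κ → ℝ) (F : ι → κ → ι → κ → ℝ) :
    ∑ v ∈ C, ∑ b : κ, p v b * ∑ v' ∈ C, ∑ a : κ, q v' a * F v b v' a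
      = ∑ v' ∈ C, ∑ a : κ, q v' a * ∑ v ∈ C, ∑ b : κ, p v b * F v b v' a := by
  simp only [Finset.mul_sum]
  calc ∑ v ∈ C, ∑ b : κ, ∑ v' ∈ C, ∑ a : κ, p v b * (q v' a * F v b v' a)
      = ∑ v ∈ C, ∑ v' ∈ C, ∑ b : κ, ∑ a : κ, p v b * (q v' a * F v b v' a) := Finset.sum_congr rfl fun _ _ => Finset.sum_comm
    _ = ∑ v' ∈ C, ∑ v ∈ C, ∑ b : κ, ∑ a : κ, p v b * (q v' a * F v b v' a) := Finset.sum_comm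
    _ = ∑ v' ∈ C, ∑ v ∈ C, ∑ a : κ, ∑ b : κ, p v b * (q v' a * F v b v' a) :=
        Finset.sum_congr rfl fun _ _ => Finset.sum_congr rfl fun _ _ => Finset.sum_comm
    _ = ∑ v' ∈ C, ∑ a : κ, ∑ v ∈ C, ∑ b : κ, p v b * (q v' a * F v b v' a) := Finset.sum_congr rfl fun _ _ => Finset.sum_comm
    _ = ∑ v' ∈ C, ∑ a : κ, ∑ v ∈ C, ∑ b : κ, q v' a * (p v b * F v b v' a) :=
        Finset.sum_congr rfl fun _ _ => Finset.sum_congr rfl fun _ _ => Finset.sum_congr rfl fun _ _ =>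
          Finset.sum_congr rfl fun _ _ => by ring

/-- [folklore] pointwise reading of row-parity-oddness: `A y x b a = -(sgnF a · sgnF b · A x y a b)`. -/
theorem parityOdd_apply {A : MKer (d + 1) (Fib d)} (h : trK A = -sgnK A) (x y : Fin (d + 1) → ℤ) (a b : Fib d) :
    A y x b a = -(sgnF a * sgnF b * A x y a b) := by
  have h1 := congrFun (congrFun (congrFun (congrFun h x) y) a) b
  simp only [trK_apply, Pi.neg_apply, sgnK_apply] at h1
  exact h1

/-- [folklore] row-parity-oddness from its pointwise reading. -/
theorem parityOdd_of_apply {A : MKer (d + 1) (Fib d)} (h : ∀ (x y : Fin (d + 1) → ℤ) (a b : Fib d), A y x b a = -(sgnF a * sgnF b * A x y a b)) :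
    trK A = -sgnK A := by
  funext x y a b
  simp only [trK_apply, Pi.neg_apply, sgnK_apply]
  exact h x y a b

/-! ### §1.1 The comb (axial) dressing: `coProjAtK`, `legCo₁At`, `legCo₂At`, `dressKAt`, `dressAt` -/

/-- [folklore] **THE SLOT WINDOW PRESERVES ROW-PARITY-ODDNESS** (it acts on the slot index only, entry by entry). -/
theorem trK_coProjAtK (ρ : Fin (d + 1) → ℤ) (N : ℕ) {S : Fin (d + 1) → (Fin (d + 1) → ℤ) → MKer (d + 1) (Fib d)}
    (hS : ∀ κ u, trK (S κ u) = -sgnK (S κ u)) (κ : Fin (d + 1)) (u : Fin (d + 1) → ℤ) :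
    trK (coProjAtK ρ N S κ u) = -sgnK (coProjAtK ρ N S κ u) := by
  refine parityOdd_of_apply fun x y a b => ?_
  rw [coProjAtK_eval, coProjAtK_eval, coProjAt_apply, coProjAt_apply, Finset.mul_sum, ← Finset.sum_neg_distrib]
  refine Finset.sum_congr rfl fun v _ => ?_
  rw [Finset.mul_sum, ← Finset.sum_neg_distrib]
  refine Finset.sum_congr rfl fun β _ => ?_
  rw [parityOdd_apply (hS β (u + v)) x y a b]
  ring

/-- [folklore] **THE SLOT WINDOW PRESERVES THE VANISHING OF THE mm BLOCK.** -/
theorem coProjAtK_inr_inr (ρ : Fin (d + 1) → ℤ) (N : ℕ) {S : Fin (d + 1) → (Fin (d + 1) → ℤ) → MKer (d + 1) (Fib d)}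
    (hS : ∀ κ u x y (m m' : Fin (d + 1)), S κ u x y (Sum.inr m) (Sum.inr m') = 0)
    (κ : Fin (d + 1)) (u x y : Fin (d + 1) → ℤ) (m m' : Fin (d + 1)) :
    coProjAtK ρ N S κ u x y (Sum.inr m) (Sum.inr m') = 0 := by
  rw [coProjAtK_eval, coProjAt_apply]
  exact Finset.sum_eq_zero fun v _ => Finset.sum_eq_zero fun β _ => by rw [hS, mul_zero]

/-- [folklore] transposition exchanges the two leg windows: `trK (legCo₁At K) = legCo₂At (trK K)` (definitional, leg by leg). -/
theorem trK_legCo₁At (ρ : Fin (d + 1) → ℤ) (N : ℕ) (K : MKer (d + 1) (Fib d)) : trK (legCo₁At ρ N K) = legCo₂At ρ N (trK K) := by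
  funext x y a b
  rcases b with β | m
  · rw [trK_apply, legCo₁At_inl, legCo₂At_inl]
    rfl
  · rw [trK_apply, legCo₁At_inr, legCo₂At_inr, trK_apply]

/-- [folklore] … and `trK (legCo₂At K) = legCo₁At (trK K)`. -/
theorem trK_legCo₂At (ρ : Fin (d + 1) → ℤ) (N : ℕ) (K : MKer (d + 1) (Fib d)) : trK (legCo₂At ρ N K) = legCo₁At ρ N (trK K) := by
  funext x y a b
  rcases a with α | m
  · rw [trK_apply, legCo₂At_inl, legCo₁At_inl]
    rfl
  · rw [trK_apply, legCo₂At_inr, legCo₁At_inr, trK_apply]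

/-- [folklore] the first-leg window commutes with sign conjugation (it does not mix field and multiplier legs). -/
theorem sgnK_legCo₁At (ρ : Fin (d + 1) → ℤ) (N : ℕ) (K : MKer (d + 1) (Fib d)) : sgnK (legCo₁At ρ N K) = legCo₁At ρ N (sgnK K) := by
  funext x y a b
  rcases a with α | m
  · rw [sgnK_apply, legCo₁At_inl, legCo₁At_inl, coProjAt_apply, coProjAt_apply, Finset.mul_sum]
    refine Finset.sum_congr rfl fun v _ => ?_
    rw [Finset.mul_sum]
    refine Finset.sum_congr rfl fun α' _ => ?_
    rw [sgnK_apply, sgnF_inl, sgnF_inl]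
    ring
  · rw [sgnK_apply, legCo₁At_inr, legCo₁At_inr, sgnK_apply]

/-- [folklore] the second-leg window commutes with sign conjugation. -/
theorem sgnK_legCo₂At (ρ : Fin (d + 1) → ℤ) (N : ℕ) (K : MKer (d + 1) (Fib d)) : sgnK (legCo₂At ρ N K) = legCo₂At ρ N (sgnK K) := by
  funext x y a b
  rcases b with β | m
  · rw [sgnK_apply, legCo₂At_inl, legCo₂At_inl, coProjAt_apply, coProjAt_apply, Finset.mul_sum]
    refine Finset.sum_congr rfl fun v _ => ?_
    rw [Finset.mul_sum]
    refine Finset.sum_congr rfl fun β' _ => ?_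
    rw [sgnK_apply, sgnF_inl, sgnF_inl]
    ring
  · rw [sgnK_apply, legCo₂At_inr, legCo₂At_inr, sgnK_apply]

/-- [folklore] the first-leg window is odd. -/
theorem legCo₁At_neg (ρ : Fin (d + 1) → ℤ) (N : ℕ) (K : MKer (d + 1) (Fib d)) : legCo₁At ρ N (-K) = -legCo₁At ρ N K := by
  funext x y a b
  rcases a with α | m
  · rw [Pi.neg_apply, Pi.neg_apply, Pi.neg_apply, Pi.neg_apply, legCo₁At_inl, legCo₁At_inl, coProjAt_apply, coProjAt_apply,
      ← Finset.sum_neg_distrib]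
    refine Finset.sum_congr rfl fun v _ => ?_
    rw [← Finset.sum_neg_distrib]
    refine Finset.sum_congr rfl fun α' _ => ?_
    simp only [Pi.neg_apply, mul_neg]
  · simp only [Pi.neg_apply, legCo₁At_inr]

/-- [folklore] the second-leg window is odd. -/
theorem legCo₂At_neg (ρ : Fin (d + 1) → ℤ) (N : ℕ) (K : MKer (d + 1) (Fib d)) : legCo₂At ρ N (-K) = -legCo₂At ρ N K := by
  funext x y a b
  rcases b with β | m
  · rw [Pi.neg_apply, Pi.neg_apply, Pi.neg_apply, Pi.neg_apply, legCo₂At_inl, legCo₂At_inl, coProjAt_apply, coProjAt_apply,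
      ← Finset.sum_neg_distrib]
    refine Finset.sum_congr rfl fun v _ => ?_
    rw [← Finset.sum_neg_distrib]
    refine Finset.sum_congr rfl fun β' _ => ?_
    simp only [Pi.neg_apply, mul_neg]
  · simp only [Pi.neg_apply, legCo₂At_inr]

/-- [folklore] **THE TWO LEG WINDOWS COMMUTE**: `legCo₂At (legCo₁At K) = legCo₁At (legCo₂At K)` (`window_comm` on the field–field block; trivial elsewhere). -/
theorem legCo₂At_legCo₁At (ρ : Fin (d + 1) → ℤ) (N : ℕ) (K : MKer (d + 1) (Fib d)) :
    legCo₂At ρ N (legCo₁At ρ N K) = legCo₁At ρ N (legCo₂At ρ N K) := by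
  funext x y a b
  rcases a with α | m <;> rcases b with β | m'
  · simp only [legCo₂At_inl, legCo₁At_inl, coProjAt_apply]
    exact window_comm (cube (d + 1) N) (fun v β' => (AxialDressingRooted.pm ρ N β' (y + v) β y : ℝ))
      (fun v' α' => (AxialDressingRooted.pm ρ N α' (x + v') α x : ℝ)) (fun v β' v' α' => K (x + v') (y + v) (Sum.inl α') (Sum.inl β'))
  · simp only [legCo₂At_inr, legCo₁At_inl, legCo₂At_inr]
  · simp only [legCo₂At_inl, legCo₁At_inr]
  · simp only [legCo₂At_inr, legCo₁At_inr]

/-- [folklore] **THE TWO-LEG COMB DRESSING PRESERVES ROW-PARITY-ODDNESS**: `trK K = -sgnK K ⟹ trK (dressKAt ρ N K) = -sgnK (dressKAt ρ N K)`. -/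
theorem trK_dressKAt (ρ : Fin (d + 1) → ℤ) (N : ℕ) {K : MKer (d + 1) (Fib d)} (hK : trK K = -sgnK K) :
    trK (dressKAt ρ N K) = -sgnK (dressKAt ρ N K) := by
  rw [dressKAt_eq, trK_legCo₂At, trK_legCo₁At, hK, legCo₂At_neg, legCo₁At_neg, ← sgnK_legCo₂At, ← sgnK_legCo₁At, ← legCo₂At_legCo₁At]

/-- [folklore] **THE TWO-LEG COMB DRESSING DOES NOT TOUCH THE mm BLOCK.** -/
theorem dressKAt_inr_inr (ρ : Fin (d + 1) → ℤ) (N : ℕ) (K : MKer (d + 1) (Fib d)) (x y : Fin (d + 1) → ℤ) (m m' : Fin (d + 1)) :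
    dressKAt ρ N K x y (Sum.inr m) (Sum.inr m') = K x y (Sum.inr m) (Sum.inr m') := by
  rw [dressKAt_eq, legCo₂At_inr, legCo₁At_inr]

/-- [folklore] **`(dressAt hr J).S` IS ROW-PARITY-ODD WHEN `J.S` IS.** -/
theorem trK_dressAt_S {N : ℕ} [NeZero N] {r : Fin (d + 1) → ℕ} (hr : r ∈ box (d + 1) N) (J : JetData d N)
    (hJ : ∀ κ u, trK (J.S κ u) = -sgnK (J.S κ u)) (κ : Fin (d + 1)) (u : Fin (d + 1) → ℤ) :
    trK ((dressAt hr J).S κ u) = -sgnK ((dressAt hr J).S κ u) := by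
  rw [dressAt_S]
  exact trK_dressKAt _ _ (trK_coProjAtK _ _ hJ κ u)

/-- [folklore] **`(dressAt hr J).S` HAS NO mm BLOCK WHEN `J.S` HAS NONE.** -/
theorem dressAt_S_inr_inr {N : ℕ} [NeZero N] {r : Fin (d + 1) → ℕ} (hr : r ∈ box (d + 1) N) (J : JetData d N)
    (hJ : ∀ κ u x y (m m' : Fin (d + 1)), J.S κ u x y (Sum.inr m) (Sum.inr m') = 0)
    (κ : Fin (d + 1)) (u x y : Fin (d + 1) → ℤ) (m m' : Fin (d + 1)) :
    (dressAt hr J).S κ u x y (Sum.inr m) (Sum.inr m') = 0 := by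
  rw [dressAt_S, dressKAt_inr_inr]
  exact coProjAtK_inr_inr _ _ hJ κ u x y m m'

/-- [folklore] **`(dressAt hr J).S` IS BLOCK-TRANSLATION COVARIANT WHEN `J.S` IS** (an2's `dressAtS_translate`, restated on the datum). -/
theorem dressAt_S_translate {N : ℕ} [NeZero N] {r : Fin (d + 1) → ℕ} (hr : r ∈ box (d + 1) N) (J : JetData d N)
    (hJ : ∀ κ u t, J.S κ (u + (N : ℤ) • t) = shiftK (-((N : ℤ) • t)) (J.S κ u))
    (κ : Fin (d + 1)) (u t : Fin (d + 1) → ℤ) :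
    (dressAt hr J).S κ (u + (N : ℤ) • t) = shiftK (-((N : ℤ) • t)) ((dressAt hr J).S κ u) := by
  rw [dressAt_S, dressAt_S]
  exact dressAtS_translate (toSite r) (one_le_of_neZero N) hJ κ u t

/-! ### §1.2 The symmetrised (block-mean) dressing: `coProjSymAtK`, `legCo₁SymAt`, `legCo₂SymAt`, `dressKSymAt`, `dressSymAt` — decl-by-decl twins -/

/-- [folklore] the symmetrised slot window preserves row-parity-oddness. -/
theorem trK_coProjSymAtK (ρ : Fin (d + 1) → ℤ) (N : ℕ) {S : Fin (d + 1) → (Fin (d + 1) → ℤ) → MKer (d + 1) (Fib d)}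
    (hS : ∀ κ u, trK (S κ u) = -sgnK (S κ u)) (κ : Fin (d + 1)) (u : Fin (d + 1) → ℤ) :
    trK (coProjSymAtK ρ N S κ u) = -sgnK (coProjSymAtK ρ N S κ u) := by
  refine parityOdd_of_apply fun x y a b => ?_
  rw [coProjSymAtK_eval, coProjSymAtK_eval, coProjSymAt_apply, coProjSymAt_apply, Finset.mul_sum, ← Finset.sum_neg_distrib]
  refine Finset.sum_congr rfl fun v _ => ?_
  rw [Finset.mul_sum, ← Finset.sum_neg_distrib]
  refine Finset.sum_congr rfl fun β _ => ?_
  rw [parityOdd_apply (hS β (u + v)) x y a b]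
  ring

/-- [folklore] the symmetrised slot window preserves the vanishing of the mm block. -/
theorem coProjSymAtK_inr_inr (ρ : Fin (d + 1) → ℤ) (N : ℕ) {S : Fin (d + 1) → (Fin (d + 1) → ℤ) → MKer (d + 1) (Fib d)}
    (hS : ∀ κ u x y (m m' : Fin (d + 1)), S κ u x y (Sum.inr m) (Sum.inr m') = 0)
    (κ : Fin (d + 1)) (u x y : Fin (d + 1) → ℤ) (m m' : Fin (d + 1)) :
    coProjSymAtK ρ N S κ u x y (Sum.inr m) (Sum.inr m') = 0 := by
  rw [coProjSymAtK_eval, coProjSymAt_apply]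
  exact Finset.sum_eq_zero fun v _ => Finset.sum_eq_zero fun β _ => by rw [hS, mul_zero]

/-- [folklore] `trK (legCo₁SymAt K) = legCo₂SymAt (trK K)`. -/
theorem trK_legCo₁SymAt (ρ : Fin (d + 1) → ℤ) (N : ℕ) (K : MKer (d + 1) (Fib d)) :
    trK (legCo₁SymAt ρ N K) = legCo₂SymAt ρ N (trK K) := by
  funext x y a b
  rcases b with β | m
  · rw [trK_apply, legCo₁SymAt_inl, legCo₂SymAt_inl]
    rfl
  · rw [trK_apply, legCo₁SymAt_inr, legCo₂SymAt_inr, trK_apply]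

/-- [folklore] `trK (legCo₂SymAt K) = legCo₁SymAt (trK K)`. -/
theorem trK_legCo₂SymAt (ρ : Fin (d + 1) → ℤ) (N : ℕ) (K : MKer (d + 1) (Fib d)) :
    trK (legCo₂SymAt ρ N K) = legCo₁SymAt ρ N (trK K) := by
  funext x y a b
  rcases a with α | m
  · rw [trK_apply, legCo₂SymAt_inl, legCo₁SymAt_inl]
    rfl
  · rw [trK_apply, legCo₂SymAt_inr, legCo₁SymAt_inr, trK_apply]

/-- [folklore] the first-leg symmetrised window commutes with sign conjugation. -/
theorem sgnK_legCo₁SymAt (ρ : Fin (d + 1) → ℤ) (N : ℕ) (K : MKer (d + 1) (Fib d)) :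
    sgnK (legCo₁SymAt ρ N K) = legCo₁SymAt ρ N (sgnK K) := by
  funext x y a b
  rcases a with α | m
  · rw [sgnK_apply, legCo₁SymAt_inl, legCo₁SymAt_inl, coProjSymAt_apply, coProjSymAt_apply, Finset.mul_sum]
    refine Finset.sum_congr rfl fun v _ => ?_
    rw [Finset.mul_sum]
    refine Finset.sum_congr rfl fun α' _ => ?_
    rw [sgnK_apply, sgnF_inl, sgnF_inl]
    ring
  · rw [sgnK_apply, legCo₁SymAt_inr, legCo₁SymAt_inr, sgnK_apply]

/-- [folklore] the second-leg symmetrised window commutes with sign conjugation. -/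
theorem sgnK_legCo₂SymAt (ρ : Fin (d + 1) → ℤ) (N : ℕ) (K : MKer (d + 1) (Fib d)) :
    sgnK (legCo₂SymAt ρ N K) = legCo₂SymAt ρ N (sgnK K) := by
  funext x y a b
  rcases b with β | m
  · rw [sgnK_apply, legCo₂SymAt_inl, legCo₂SymAt_inl, coProjSymAt_apply, coProjSymAt_apply, Finset.mul_sum]
    refine Finset.sum_congr rfl fun v _ => ?_
    rw [Finset.mul_sum]
    refine Finset.sum_congr rfl fun β' _ => ?_
    rw [sgnK_apply, sgnF_inl, sgnF_inl]
    ring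
  · rw [sgnK_apply, legCo₂SymAt_inr, legCo₂SymAt_inr, sgnK_apply]

/-- [folklore] the first-leg symmetrised window is odd. -/
theorem legCo₁SymAt_neg (ρ : Fin (d + 1) → ℤ) (N : ℕ) (K : MKer (d + 1) (Fib d)) : legCo₁SymAt ρ N (-K) = -legCo₁SymAt ρ N K := by
  funext x y a b
  rcases a with α | m
  · rw [Pi.neg_apply, Pi.neg_apply, Pi.neg_apply, Pi.neg_apply, legCo₁SymAt_inl, legCo₁SymAt_inl, coProjSymAt_apply, coProjSymAt_apply,
      ← Finset.sum_neg_distrib]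
    refine Finset.sum_congr rfl fun v _ => ?_
    rw [← Finset.sum_neg_distrib]
    refine Finset.sum_congr rfl fun α' _ => ?_
    simp only [Pi.neg_apply, mul_neg]
  · simp only [Pi.neg_apply, legCo₁SymAt_inr]

/-- [folklore] the second-leg symmetrised window is odd. -/
theorem legCo₂SymAt_neg (ρ : Fin (d + 1) → ℤ) (N : ℕ) (K : MKer (d + 1) (Fib d)) : legCo₂SymAt ρ N (-K) = -legCo₂SymAt ρ N K := by
  funext x y a b
  rcases b with β | m
  · rw [Pi.neg_apply, Pi.neg_apply, Pi.neg_apply, Pi.neg_apply, legCo₂SymAt_inl, legCo₂SymAt_inl, coProjSymAt_apply, coProjSymAt_apply,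
      ← Finset.sum_neg_distrib]
    refine Finset.sum_congr rfl fun v _ => ?_
    rw [← Finset.sum_neg_distrib]
    refine Finset.sum_congr rfl fun β' _ => ?_
    simp only [Pi.neg_apply, mul_neg]
  · simp only [Pi.neg_apply, legCo₂SymAt_inr]

/-- [folklore] the two symmetrised leg windows commute. -/
theorem legCo₂SymAt_legCo₁SymAt (ρ : Fin (d + 1) → ℤ) (N : ℕ) (K : MKer (d + 1) (Fib d)) :
    legCo₂SymAt ρ N (legCo₁SymAt ρ N K) = legCo₁SymAt ρ N (legCo₂SymAt ρ N K) := by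
  funext x y a b
  rcases a with α | m <;> rcases b with β | m'
  · simp only [legCo₂SymAt_inl, legCo₁SymAt_inl, coProjSymAt_apply]
    exact window_comm (cube (d + 1) N) (fun v β' => SymmetrisedDressingMatrix.pmSymBm ρ N β' (y + v) β y)
      (fun v' α' => SymmetrisedDressingMatrix.pmSymBm ρ N α' (x + v') α x) (fun v β' v' α' => K (x + v') (y + v) (Sum.inl α') (Sum.inl β'))
  · simp only [legCo₂SymAt_inr, legCo₁SymAt_inl, legCo₂SymAt_inr]
  · simp only [legCo₂SymAt_inl, legCo₁SymAt_inr]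
  · simp only [legCo₂SymAt_inr, legCo₁SymAt_inr]

/-- [folklore] **THE TWO-LEG SYMMETRISED DRESSING PRESERVES ROW-PARITY-ODDNESS.** -/
theorem trK_dressKSymAt (ρ : Fin (d + 1) → ℤ) (N : ℕ) {K : MKer (d + 1) (Fib d)} (hK : trK K = -sgnK K) :
    trK (dressKSymAt ρ N K) = -sgnK (dressKSymAt ρ N K) := by
  rw [dressKSymAt_eq_legs, trK_legCo₂SymAt, trK_legCo₁SymAt, hK, legCo₂SymAt_neg, legCo₁SymAt_neg, ← sgnK_legCo₂SymAt, ← sgnK_legCo₁SymAt,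
    ← legCo₂SymAt_legCo₁SymAt]

/-- [folklore] **THE TWO-LEG SYMMETRISED DRESSING DOES NOT TOUCH THE mm BLOCK.** -/
theorem dressKSymAt_inr_inr (ρ : Fin (d + 1) → ℤ) (N : ℕ) (K : MKer (d + 1) (Fib d)) (x y : Fin (d + 1) → ℤ) (m m' : Fin (d + 1)) :
    dressKSymAt ρ N K x y (Sum.inr m) (Sum.inr m') = K x y (Sum.inr m) (Sum.inr m') := by
  rw [dressKSymAt_eq_legs, legCo₂SymAt_inr, legCo₁SymAt_inr]

/-- [folklore] **`(dressSymAt hr J).S` IS ROW-PARITY-ODD WHEN `J.S` IS.** -/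
theorem trK_dressSymAt_S {N : ℕ} [NeZero N] {r : Fin (d + 1) → ℕ} (hr : r ∈ box (d + 1) N) (J : JetData d N)
    (hJ : ∀ κ u, trK (J.S κ u) = -sgnK (J.S κ u)) (κ : Fin (d + 1)) (u : Fin (d + 1) → ℤ) :
    trK ((dressSymAt hr J).S κ u) = -sgnK ((dressSymAt hr J).S κ u) := by
  rw [dressSymAt_S]
  exact trK_dressKSymAt _ _ (trK_coProjSymAtK _ _ hJ κ u)

/-- [folklore] **`(dressSymAt hr J).S` HAS NO mm BLOCK WHEN `J.S` HAS NONE.** -/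
theorem dressSymAt_S_inr_inr {N : ℕ} [NeZero N] {r : Fin (d + 1) → ℕ} (hr : r ∈ box (d + 1) N) (J : JetData d N)
    (hJ : ∀ κ u x y (m m' : Fin (d + 1)), J.S κ u x y (Sum.inr m) (Sum.inr m') = 0)
    (κ : Fin (d + 1)) (u x y : Fin (d + 1) → ℤ) (m m' : Fin (d + 1)) :
    (dressSymAt hr J).S κ u x y (Sum.inr m) (Sum.inr m') = 0 := by
  rw [dressSymAt_S, dressKSymAt_inr_inr]
  exact coProjSymAtK_inr_inr _ _ hJ κ u x y m m'

/-- [folklore] **`(dressSymAt hr J).S` IS BLOCK-TRANSLATION COVARIANT WHEN `J.S` IS** (an2's `dressSymAtS_translate`, restated on the datum). -/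
theorem dressSymAt_S_translate {N : ℕ} [NeZero N] {r : Fin (d + 1) → ℕ} (hr : r ∈ box (d + 1) N) (J : JetData d N)
    (hJ : ∀ κ u t, J.S κ (u + (N : ℤ) • t) = shiftK (-((N : ℤ) • t)) (J.S κ u))
    (κ : Fin (d + 1)) (u t : Fin (d + 1) → ℤ) :
    (dressSymAt hr J).S κ (u + (N : ℤ) • t) = shiftK (-((N : ℤ) • t)) ((dressSymAt hr J).S κ u) := by
  rw [dressSymAt_S, dressSymAt_S]
  exact dressSymAtS_translate (toSite r) (one_le_of_neZero N) hJ κ u t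

end Transport

/-! ## §2 The road's `hSfm` ∕ `hSff` shapes from row-parity-oddness (generic `d`) -/

section Shapes

/-- [folklore] **`hSfm` FROM PARITY**: the fm entry is the kernel-transposed mf entry. -/
theorem fm_eq_of_parityOdd {A : MKer (d + 1) (Fib d)} (h : trK A = -sgnK A) (x y : Fin (d + 1) → ℤ) (c b : Fin (d + 1)) :
    A x y (Sum.inl c) (Sum.inr b) = A y x (Sum.inr b) (Sum.inl c) := by
  rw [parityOdd_apply h y x (Sum.inr b) (Sum.inl c), sgnF_inl, sgnF_inr]
  ring

/-- [folklore] **`hSff` FROM PARITY**: the ff block is antisymmetric under the kernel transposition. -/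
theorem ff_eq_of_parityOdd {A : MKer (d + 1) (Fib d)} (h : trK A = -sgnK A) (x y : Fin (d + 1) → ℤ) (c b : Fin (d + 1)) :
    A x y (Sum.inl c) (Sum.inl b) = -A y x (Sum.inl b) (Sum.inl c) := by
  rw [parityOdd_apply h y x (Sum.inl b) (Sum.inl c), sgnF_inl, sgnF_inl]
  ring

end Shapes

end Summit.QuantumFields.BalabanUV.Beta.D1BFx.DressingParityTransport

end
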